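import Summits.ValiantsHypothesis.ValiantsHypothesis.Theorems.GrenetZeonDualUnipotentThreeHalvesWordFlagDuality
import Summits.ValiantsHypothesis.ValiantsHypothesis.Theorems.GrenetZeonDualUnipotentThreeHalvesWordFlagPencil

/-!
# `GrenetZeon.DualUnipotentThreeHalves` (stmt-ValiantsHypothesis-24318), R2 `HeavyTopLaw` — WEIGHT CHAINS of submodules
# certify flag-cheapness (coordinate-free form of Theorem G″; instrument, director-valiant R259 (a))

Coordinate-free companion of ✓ `…HeavyTopInvariantFlag.flagCheap_of_weight_levels` (p645496), in the shape the WAVE-2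
card `Cruxes/DualUnipotentThreeHalves/Ideas/krylov-seed.md` (val-idea-26) asks for in its lemma (B): instead of a constant
change of basis `P` and a level function, take an antitone CHAIN of submodules `⊤ = F 0 ≥ F 1 ≥ ⋯ ≥ F L = ⊥` of `ℂ^m` such that
every value `N(x)` LOWERS the chain by at most `r` (`N(x)·F_t ⊆ F_{t−r}`) and every top `N_lin(v)`, `v ∈ K`, RAISES it by at
least `c ≥ 1` (`N_lin(v)·F_t ⊆ F_{t+c}`).  Then `(k+1)·n < dim K` with `k ≥ ⌊(L − 1 + r(n−1))/(c + r)⌋` gives `FlagCheap n m N`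
(`flagCheap_of_weight_chain`) — one line from the tree's ✓ `flagAdaptedUpTo_of_chain` (WordFlagDuality) and ✓ `coeffs_map_lineSubst`
(WordFlagPencil).  A Krylov/Hessenberg chain `F_{t+1} = S + F_t + W·F_t` of the pencil space `W = ℂN(0) + N_lin(ℂ^{n×n})`, read
downward, is such a chain with `r = 1`; the card's `weightThin_of_krylov` is this theorem with `r = c = 1`.
Also recorded: the INVARIANT-chain case `r = 0`, `c = 1` (`flagCheap_of_invariant_chain`, budget `L − 1`).

Honest framing: certificate plumbing for instances of the LAW R2; nothing here proves or refutes `HeavyTopLaw`, 24318, S3b or 8062;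
`VP ≠ VNP` is not moved; no summit statement is proved here.  No definitions, no named facts. [folklore]
-/

noncomputable section

-- single-conjunct layout: Sub = Summit, duplicated namespace component intended
set_option linter.dupNamespace false

namespace Summit.ValiantsHypothesis.ValiantsHypothesis.Theorems.GrenetZeon.HeavyTopWeightChain

open MvPolynomial Matrix
open Summit.ValiantsHypothesis.ValiantsHypothesis.Cruxes.TwoDimCoefficients.DimTwoCases (AffMat IsAffine)
open Summit.ValiantsHypothesis.ValiantsHypothesis.Theorems.GrenetZeon.RadicalSplit

variable {m : ℕ}

/-- **Theorem G″, chain form.**  An antitone chain of submodules `⊤ = F 0 ≥ ⋯ ≥ F L = ⊥` which every value `N(x)` of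
the affine pencil lowers by at most `r` and which every top `N_lin(v)`, `v ∈ K`, raises by at least `c ≥ 1`, together
with `(k+1)·n < dim K` for some `k ≥ ⌊(L − 1 + r(n−1))/(c+r)⌋`, makes `N` flag-cheap. [folklore; ✓ `flagAdaptedUpTo_of_chain`] -/
theorem flagCheap_of_weight_chain {n : ℕ} (N : AffMat n m) (hN : IsAffine N)
    (F : ℕ → Submodule ℂ (Fin m → ℂ)) (hanti : Antitone F) (hF0 : F 0 = ⊤) (L : ℕ) (hFL : F L = ⊥)
    (r c : ℕ) (hc : 1 ≤ c)
    (hdrop : ∀ (x : Fin n × Fin n → ℂ) (t : ℕ), ∀ w ∈ F t, (N.map (MvPolynomial.eval x)) *ᵥ w ∈ F (t - r))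
    (K : Submodule ℂ (Fin n × Fin n → ℂ))
    (hclimb : ∀ v ∈ K, ∀ (t : ℕ), ∀ w ∈ F t, (linPart N v) *ᵥ w ∈ F (t + c))
    (k : ℕ) (hk : (L - 1 + r * (n - 1)) / (c + r) ≤ k) (hdim : (k + 1) * n < Module.finrank ℂ K) :
    FlagCheap n m N := by
  refine ⟨K, k, fun x v hv => ?_, hdim⟩
  obtain ⟨h0, h1, h2⟩ := coeffs_map_lineSubst N hN x v
  refine flagAdaptedUpTo_of_chain F hanti hF0 hFL (N.map (lineSubst x v)) r c hc ?_ ?_ h2 hk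
  · intro t w hw; rw [h0]; exact hdrop x t w hw
  · intro t w hw; rw [h1]; exact hclimb v hv t w hw

/-- **Invariant chains** (`r = 0`, `c = 1`): a chain of submodules invariant under every value of the pencil, with the tops
of `K` raising it strictly, (`L ≥ 1`) gives `FlagCheap` with budget `L − 1` — the coordinate-free form of ✓
`…HeavyTopInvariantFlag.flagCheap_of_block_levels`. [folklore] -/
theorem flagCheap_of_invariant_chain {n : ℕ} (N : AffMat n m) (hN : IsAffine N)
    (F : ℕ → Submodule ℂ (Fin m → ℂ)) (hanti : Antitone F) (hF0 : F 0 = ⊤) (L : ℕ) (hFL : F L = ⊥)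
    (hinv : ∀ (x : Fin n × Fin n → ℂ) (t : ℕ), ∀ w ∈ F t, (N.map (MvPolynomial.eval x)) *ᵥ w ∈ F t)
    (K : Submodule ℂ (Fin n × Fin n → ℂ))
    (hclimb : ∀ v ∈ K, ∀ (t : ℕ), ∀ w ∈ F t, (linPart N v) *ᵥ w ∈ F (t + 1))
    (hL : 1 ≤ L) (hdim : L * n < Module.finrank ℂ K) : FlagCheap n m N := by
  refine flagCheap_of_weight_chain N hN F hanti hF0 L hFL 0 1 le_rfl (fun x t w hw => by simpa using hinv x t w hw)
    K hclimb (L - 1) (by simp) ?_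
  have : L - 1 + 1 = L := Nat.sub_add_cancel hL
  rw [this]; exact hdim

end Summit.ValiantsHypothesis.ValiantsHypothesis.Theorems.GrenetZeon.HeavyTopWeightChain

end
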